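import Summits.Ventures.CertifiedManyBodySolver.Certificates.HubbardSquare_nbox_edoped_tpm1o4_thermal_b4_PHretype3x3_j273931
import Summits.Ventures.CertifiedManyBodySolver.Certificates.HubbardSquare_nbox_edoped_tpm1o4_thermal_lower_PH_kernel
import Summits.Ventures.CertifiedManyBodySolver.Downfold.BoxesNCCO
import Summits.Ventures.CertifiedManyBodySolver.Downfold.TAxisSeam
import HarnessLib

/-!
# THE FIRST TYPED T-AXIS WORD ON AN ELECTRON-DOPED BOX: hubbard-downfold-unc-2's NCCO object-M `(t′, U)`-piece words at `β ≥ 4`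
# (`edopedCell_thermal_upper_b4_edBoxLow/_edBoxHigh_of_le`, `edopedCell_thermal_lower_edBoxLow/_edBoxHigh`, 2026-08-27T15:46–15:54Z) read through
# `TAxisSeam` on the typed box of record `boxNCCOM_M20v19` (Nd₁.₈₅Ce₀.₁₅CuO₄, VALIDATION-SET #20, object M, `t ∈ [0.39, 0.52]` eV)

Venture CertifiedManyBodySolver, cell `pub/hubbard-downfold` (stage S1 ↔ S2 seam, D-0099 T axis), seat hubbard-downfold-mod-1; namespace
`Summit.Ventures.CertifiedManyBodySolver.Downfold`. unc-2 (INBOX 2026-08-27T15:59:15Z «mod-1 (TAxisSeam: electron-doped typed words by name)») landed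
the ELECTRON-DOPED filling leg on EVERY torus (no `4 ∣ L` flag): on the NCCO #20 object-M `(t′, U, n)` cell `[−269/1000, −21/125] × [181/100, 867/100] ×
[109/100, 117/100]` — exactly the `(tp/t, U/t, n)` cell of `boxNCCOM_M20v19` (`BoxesNCCO.lean`, §OF-RECORD v1.9) — split at `U = 8`:
LOW piece `U ≤ 8` (C2-only route, β = 0 entropy anchor): for every `β ≥ 4`, `e(ω) ≤ 1.0712784075`, floor `−1.6663911992` (kernel, every `β`);
HIGH sliver `U ≥ 8` (C1 route, eng-2's `cert_feC1_3x2_b1o8_j263703`): `e(ω) ≤ 1.4700185963`, floor `−1.1092911992`.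
(`e` = mean energy per site of `H(1, s, U) = T + U·D` in a torus-limit sector-Gibbs state; positive caps because `n > 1` forces `D ≥ n − 1`.)

* §0 `boxNCCOM_M20v19_ttPrimeThermal_of_cellWindow` — the NCCO-M-cell PLUMBING once (pattern `BoxesS2Cell1ThermalRays` §0): any cell word of the
  `_of_le` argument shape at every `β ≥ k` ↦ a typed word for every temperature cell `Θ = [kT₁, kT₂]` (eV, `0 < kT₁`) with `k·kT₂ ≤ 39/100` (`t₁ = 0.39`).
* §1 `nccoMCell_ttPrimeThermal_window_of_le_4` — the two pieces and the two kernel floors as ONE cell word at `β ≥ 4`: `e(ω) ∈ [−1.6663911992, 1.4700185963]`;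
  `nccoMCell_ttPrimeThermal_windowU_of_le_4` — the same RESOLVED at `U = 8` (`U ≤ 8 ⇒ [−1.6663911992, 1.0712784075]`, `U ≥ 8 ⇒ [−1.1092911992, 1.4700185963]`).
* §2 THE TYPED WORDS: `boxNCCOM_M20v19_ttPrimeThermal_window_b4` — for every `Θ` with `kT₂ ≤ 39/400` eV (≈ 1131 K ⊇ every map row) and every `kT ∈ Θ`:
  on `boxNCCOM_M20v19`, for every `β' ≥ p t_eV/kT` and every torus-limit sector-Gibbs state of `H(1, p tp/t, p U/t)` at `β'`, filling `p n`:
  **`e(ω) ∈ [−1.6663911992, 1.4700185963]`**; `…_windowU_b4` the `U/t = 8`-resolved version; `…_b4_maps` the instance `Θ = [1/2000, 39/400]`.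

HONEST FRAMING — READ THIS FIRST: object M carries `tpp/t ∈ [0.118, 0.219]` and `tperp/t ∈ [0.001, 0.004]`; the Hamiltonian in these words is the
member's `t–t′` TRUNCATION `H(1, p tp/t, p U/t)` (no `t″`, no `t⊥`) — the tree has NO thermal `t″` seam (at `T = 0` the kinematic seam
`TppSeamFilling.holdsOn_tiGroundEnergyDensityAt_objectM_kinematic` prices `t″` at `≤ (16/π²)·0.219 ≤ 0.356·t`, `nCCOM_M20v19_allowance_le`; a Gibbs-state
analogue is not in the tree and is NOT claimed). ENERGY windows at `T > 0` in units of the member's `t`, conditional on unc-2's named certificate node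
`hC2 : cert_c2sector_tp1o4_3x3_b4_j273931` and eng-2's `hC1 : cert_feC1_3x2_b1o8_j263703` exactly as in their theorems; the box is S1's typed NCCO
object-M box (a modelling frame: `B.Mem p`); torus-limit qualifiers are unc-2's (every torus); nothing here is a phase sentence, an order word or a `T_c`.
The object-E boxes (`boxNCCOE_M20v19`, `tp/t_eff ∈ [−0.62, −0.51]`) and the M55/M56 columns (`n ∈ [1.06, 1.12]`, `[0.99, 1.01]`) are NOT covered by
these cells — no word is claimed on them. Everything is PROVED; no definition, no `sorry`.
-/

noncomputable section

namespace Summit.Ventures.CertifiedManyBodySolver.Downfold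

open NonemptyInterval Literature.MathematicalPhysics.QuantumLattice
  Literature.MathematicalPhysics.QuantumLattice.ThermodynamicLimit
  Literature.MathematicalPhysics.QuantumLattice.InfVolFermionState
  Literature.Probability.LatticeModels _root_.Filter
  Summit.Ventures.CertifiedManyBodySolver.Certificates

open scoped ComplexOrder

/-! ### §0 The NCCO object-M cell plumbing, once -/

/-- **NCCO-M-CELL PLUMBING.** Any word `W β s U n ω` on the cell `[−269/1000, −21/125] × [181/100, 867/100] × [109/100, 117/100]` of the `_of_le` shape
(valid at every `β ≥ k`, every torus-limit sector-Gibbs state of `H(1, s, U)` at filling `n`), with conclusion `P (U) (e(ω))` for an arbitrary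
predicate `P : ℝ → ℝ → Prop` of `(U, e)`, is a TYPED word on `boxNCCOM_M20v19` at physical temperature: for every temperature cell `Θ = [kT₁, kT₂]`
(eV) with `0 < kT₁`, `k·kT₂ ≤ 39/100`, every `kT ∈ Θ`, member `p`, `β' ≥ p t_eV/kT`: `P (p U/t) (e(ω))`
(`TAxisSeam.holdsOn_oneBand_of_cell_invTemp_of_monotone`; `t₁ = 39/100`). [cite: Israel1979, Thm. I.3.4] -/
theorem boxNCCOM_M20v19_ttPrimeThermal_of_cellWindow {k : ℝ} {P : ℝ → ℝ → Prop}
    (hwin : ∀ ⦃β : ℝ⦄, k ≤ β → ∀ ⦃s U n : ℝ⦄, -269 / 1000 ≤ s → s ≤ -21 / 125 → 181 / 100 ≤ U → U ≤ 867 / 100 →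
      109 / 100 ≤ n → n ≤ 117 / 100 → ∀ ⦃ω : InfVolFermionState 2⦄ ⦃Ls : ℕ → ℕ⦄, Tendsto Ls atTop atTop →
      ω.IsTorusLimitOfMixture (sectorGibbsCount n) (fun L => sectorGibbsWeightTT' β 1 s U n L)
        (fun L => sectorGibbsVectorTT' 1 s U n L) Ls →
      P U (ω.meanEnergy (hubbardTTPrimeFermionInteraction 1 s U) 1))
    {Θ : NonemptyInterval ℚ} (hΘ : 0 < Θ.fst) (hΘk : k * (Θ.snd : ℝ) ≤ 39 / 100) {kT : ℝ} (hk : kT ∈ Θ.ratCast ℝ) :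
    HoldsOn (fun p : OneBandCoord → ℝ => ∀ β' : ℝ, p .tEV / kT ≤ β' →
      ∀ (ω : InfVolFermionState 2) (Ls : ℕ → ℕ), Tendsto Ls atTop atTop →
        ω.IsTorusLimitOfMixture (sectorGibbsCount (p .filling))
          (fun L => sectorGibbsWeightTT' β' 1 (p .tpOverT) (p .UOverT) (p .filling) L)
          (fun L => sectorGibbsVectorTT' 1 (p .tpOverT) (p .UOverT) (p .filling) L) Ls →
        P (p .UOverT) (ω.meanEnergy (hubbardTTPrimeFermionInteraction 1 (p .tpOverT) (p .UOverT)) 1))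
      boxNCCOM_M20v19 := by
  have hΘ2' : (0 : ℚ) < Θ.snd := lt_of_lt_of_le hΘ Θ.fst_le_snd
  have hΘ2r : (0 : ℝ) < (Θ.snd : ℝ) := by exact_mod_cast hΘ2'
  have hβ0 : k ≤ (((39 / 100 : ℚ) / Θ.snd : ℚ) : ℝ) := by
    have hc : (((39 / 100 : ℚ) / Θ.snd : ℚ) : ℝ) = (39 / 100 : ℝ) / (Θ.snd : ℝ) := by push_cast; ring
    rw [hc, le_div_iff₀ hΘ2r]
    exact hΘk
  refine holdsOn_oneBand_of_cell_invTemp_of_monotone (B := boxNCCOM_M20v19) (eS := nCCOM_M20v19_tp)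
    (eU := nCCOM_M20v19_U) (eN := nCCOM_M20v19_n) (eT := nCCOM_M20v19_t) rfl rfl rfl rfl
    (by rw [nCCOM_M20v19_t, Entry.encl_ofEnds_fst]; norm_num) hΘ
    (W₁ := fun s u n β => ∀ β' : ℝ, β ≤ β' →
      ∀ (ω : InfVolFermionState 2) (Ls : ℕ → ℕ), Tendsto Ls atTop atTop →
        ω.IsTorusLimitOfMixture (sectorGibbsCount n) (fun L => sectorGibbsWeightTT' β' 1 s u n L)
          (fun L => sectorGibbsVectorTT' 1 s u n L) Ls →
        P u (ω.meanEnergy (hubbardTTPrimeFermionInteraction 1 s u) 1))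
    (fun s u n β β' _ _ _ hββ' hW β'' hβ'' => hW β'' (le_trans hββ' hβ''))
    (fun s u n hs hu hn β' hβ' ω Ls hLs h => ?_) hk
  have hs' := mem_ratCast_iff.1 hs
  have hu' := mem_ratCast_iff.1 hu
  have hn' := mem_ratCast_iff.1 hn
  rw [nCCOM_M20v19_tp, Entry.encl_ofEnds_fst, Entry.encl_ofEnds_snd] at hs'
  rw [nCCOM_M20v19_U, Entry.encl_ofEnds_fst, Entry.encl_ofEnds_snd] at hu'
  rw [nCCOM_M20v19_n, Entry.encl_ofEnds_fst, Entry.encl_ofEnds_snd] at hn'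
  push_cast at hs' hu' hn'
  have hle : k ≤ β' := by
    have ht : (((39 / 100 : ℚ) / Θ.snd : ℚ) : ℝ) = (((nCCOM_M20v19_t.encl.fst / Θ.snd : ℚ)) : ℝ) := by
      rw [nCCOM_M20v19_t, Entry.encl_ofEnds_fst]
    linarith [hβ0, ht ▸ hβ']
  exact hwin hle (by linarith [hs'.1]) (by linarith [hs'.2]) (by linarith [hu'.1]) (by linarith [hu'.2])
    (by linarith [hn'.1]) (by linarith [hn'.2]) hLs h

/-! ### §1 unc-2's two pieces and the two kernel floors as ONE cell word at `β ≥ 4` -/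

/-- **THE WHOLE NCCO object-M cell at every `β ≥ 4`, TWO-SIDED: `e(ω) ∈ [−1.6663911992, 1.4700185963]`** — `U ≤ 8`: unc-2's
`edopedCell_thermal_lower_edBoxLow` / `edopedCell_thermal_upper_b4_edBoxLow_of_le` (`≤ 1.0712784075`); `U ≥ 8`: `edopedCell_thermal_lower_edBoxHigh`
(`≥ −1.1092911992`) / `edopedCell_thermal_upper_b4_edBoxHigh_of_le`; BY NAME. Strength = `hC2 ∧ hC1` ∧ kernel theorems.
[cite: LiebWuPhysicaA2003, §1 eq. (3)] [cite: Israel1979, Lemma II.3.1] [cite: Ruelle1969, §3.4] -/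
theorem nccoMCell_ttPrimeThermal_window_of_le_4 (hC2 : cert_c2sector_tp1o4_3x3_b4_j273931) (hC1 : cert_feC1_3x2_b1o8_j263703)
    {β : ℝ} (hle : (4 : ℝ) ≤ β) {s U n : ℝ}
    (hs1 : -269 / 1000 ≤ s) (hs2 : s ≤ -21 / 125) (hU1 : 181 / 100 ≤ U) (hU2 : U ≤ 867 / 100) (hn1 : 109 / 100 ≤ n) (hn2 : n ≤ 117 / 100)
    {ω : InfVolFermionState 2} {Ls : ℕ → ℕ} (hLs : Tendsto Ls atTop atTop)
    (h : ω.IsTorusLimitOfMixture (sectorGibbsCount n) (fun L => sectorGibbsWeightTT' β 1 s U n L)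
      (fun L => sectorGibbsVectorTT' 1 s U n L) Ls) :
    ω.meanEnergy (hubbardTTPrimeFermionInteraction 1 s U) 1 ∈ Set.Icc (-1.6663911992 : ℝ) (1.4700185963) := by
  rcases le_total U 8 with hU8 | hU8
  · exact ⟨edopedCell_thermal_lower_edBoxLow hs1 hs2 hU1 hU8 hn1 hn2 hLs h,
      (edopedCell_thermal_upper_b4_edBoxLow_of_le hC2 hle hs1 hs2 hU1 hU8 hn1 hn2 hLs h).trans (by norm_num)⟩
  · exact ⟨le_trans (by norm_num) (edopedCell_thermal_lower_edBoxHigh hs1 hs2 hU8 hU2 hn1 hn2 hLs h),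
      edopedCell_thermal_upper_b4_edBoxHigh_of_le hC2 hC1 hle hs1 hs2 hU8 hU2 hn1 hn2 hLs h⟩

/-- **The same, RESOLVED at `U = 8`** (the information unc-2's two pieces actually carry): `U ≤ 8 ⇒ e(ω) ∈ [−1.6663911992, 1.0712784075]` and
`8 ≤ U ⇒ e(ω) ∈ [−1.1092911992, 1.4700185963]`, every `β ≥ 4`. [cite: LiebWuPhysicaA2003, §1 eq. (3)] [cite: Israel1979, Lemma II.3.1] [cite: Ruelle1969, §3.4] -/
theorem nccoMCell_ttPrimeThermal_windowU_of_le_4 (hC2 : cert_c2sector_tp1o4_3x3_b4_j273931) (hC1 : cert_feC1_3x2_b1o8_j263703)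
    {β : ℝ} (hle : (4 : ℝ) ≤ β) {s U n : ℝ}
    (hs1 : -269 / 1000 ≤ s) (hs2 : s ≤ -21 / 125) (hU1 : 181 / 100 ≤ U) (hU2 : U ≤ 867 / 100) (hn1 : 109 / 100 ≤ n) (hn2 : n ≤ 117 / 100)
    {ω : InfVolFermionState 2} {Ls : ℕ → ℕ} (hLs : Tendsto Ls atTop atTop)
    (h : ω.IsTorusLimitOfMixture (sectorGibbsCount n) (fun L => sectorGibbsWeightTT' β 1 s U n L)
      (fun L => sectorGibbsVectorTT' 1 s U n L) Ls) :
    (U ≤ 8 → ω.meanEnergy (hubbardTTPrimeFermionInteraction 1 s U) 1 ∈ Set.Icc (-1.6663911992 : ℝ) (1.0712784075)) ∧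
      (8 ≤ U → ω.meanEnergy (hubbardTTPrimeFermionInteraction 1 s U) 1 ∈ Set.Icc (-1.1092911992 : ℝ) (1.4700185963)) :=
  ⟨fun hU8 => ⟨edopedCell_thermal_lower_edBoxLow hs1 hs2 hU1 hU8 hn1 hn2 hLs h,
      edopedCell_thermal_upper_b4_edBoxLow_of_le hC2 hle hs1 hs2 hU1 hU8 hn1 hn2 hLs h⟩,
    fun hU8 => ⟨edopedCell_thermal_lower_edBoxHigh hs1 hs2 hU8 hU2 hn1 hn2 hLs h,
      edopedCell_thermal_upper_b4_edBoxHigh_of_le hC2 hC1 hle hs1 hs2 hU8 hU2 hn1 hn2 hLs h⟩⟩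

/-! ### §2 The typed T-axis words on `boxNCCOM_M20v19` -/

/-- **TYPED T-AXIS WORD on `boxNCCOM_M20v19`** (Nd₁.₈₅Ce₀.₁₅CuO₄ object M; any temperature cell `Θ ⊂ (0, 39/400]` eV, i.e. `T ≤ 1131 K`): for every
`kT ∈ Θ`, every member `p`, every `β' ≥ p t_eV/kT` and every torus-limit sector-Gibbs state `ω` of the member's `t–t′` unit model
`H(1, p tp/t, p U/t)` at `β'`, filling `p n`: **`e(ω) ∈ [−1.6663911992, 1.4700185963]`** (units of `t`) — §1 through §0 (`β̃₀ = 0.39/kT₂ ≥ 4`).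
`t″`-TRUNCATED model (see the file header). [cite: Israel1979, Thm. I.3.4] [cite: LiebWuPhysicaA2003, §1 eq. (3)] [cite: Israel1979, Lemma II.3.1] -/
theorem boxNCCOM_M20v19_ttPrimeThermal_window_b4 (hC2 : cert_c2sector_tp1o4_3x3_b4_j273931) (hC1 : cert_feC1_3x2_b1o8_j263703)
    {Θ : NonemptyInterval ℚ} (hΘ : 0 < Θ.fst) (hΘ2 : Θ.snd ≤ 39 / 400) {kT : ℝ} (hk : kT ∈ Θ.ratCast ℝ) :
    HoldsOn (fun p : OneBandCoord → ℝ => ∀ β' : ℝ, p .tEV / kT ≤ β' →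
      ∀ (ω : InfVolFermionState 2) (Ls : ℕ → ℕ), Tendsto Ls atTop atTop →
        ω.IsTorusLimitOfMixture (sectorGibbsCount (p .filling))
          (fun L => sectorGibbsWeightTT' β' 1 (p .tpOverT) (p .UOverT) (p .filling) L)
          (fun L => sectorGibbsVectorTT' 1 (p .tpOverT) (p .UOverT) (p .filling) L) Ls →
        ω.meanEnergy (hubbardTTPrimeFermionInteraction 1 (p .tpOverT) (p .UOverT)) 1 ∈
          Set.Icc (-1.6663911992 : ℝ) (1.4700185963)) boxNCCOM_M20v19 := by
  have hΘ2r : ((Θ.snd : ℚ) : ℝ) ≤ (((39 / 400 : ℚ)) : ℝ) := by exact_mod_cast hΘ2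
  exact boxNCCOM_M20v19_ttPrimeThermal_of_cellWindow (k := 4) (P := fun _ e => e ∈ Set.Icc (-1.6663911992 : ℝ) (1.4700185963))
    (fun β hle s U n hs1 hs2 hU1 hU2 hn1 hn2 ω Ls hLs h =>
      nccoMCell_ttPrimeThermal_window_of_le_4 hC2 hC1 hle hs1 hs2 hU1 hU2 hn1 hn2 hLs h)
    hΘ (by push_cast at hΘ2r; linarith) hk

/-- **The `U/t = 8`-RESOLVED typed word**: on `boxNCCOM_M20v19`, same quantifiers, `p U/t ≤ 8 ⇒ e(ω) ∈ [−1.6663911992, 1.0712784075]` and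
`8 ≤ p U/t ⇒ e(ω) ∈ [−1.1092911992, 1.4700185963]`. [cite: Israel1979, Thm. I.3.4] [cite: LiebWuPhysicaA2003, §1 eq. (3)] [cite: Israel1979, Lemma II.3.1] -/
theorem boxNCCOM_M20v19_ttPrimeThermal_windowU_b4 (hC2 : cert_c2sector_tp1o4_3x3_b4_j273931) (hC1 : cert_feC1_3x2_b1o8_j263703)
    {Θ : NonemptyInterval ℚ} (hΘ : 0 < Θ.fst) (hΘ2 : Θ.snd ≤ 39 / 400) {kT : ℝ} (hk : kT ∈ Θ.ratCast ℝ) :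
    HoldsOn (fun p : OneBandCoord → ℝ => ∀ β' : ℝ, p .tEV / kT ≤ β' →
      ∀ (ω : InfVolFermionState 2) (Ls : ℕ → ℕ), Tendsto Ls atTop atTop →
        ω.IsTorusLimitOfMixture (sectorGibbsCount (p .filling))
          (fun L => sectorGibbsWeightTT' β' 1 (p .tpOverT) (p .UOverT) (p .filling) L)
          (fun L => sectorGibbsVectorTT' 1 (p .tpOverT) (p .UOverT) (p .filling) L) Ls →
        (p .UOverT ≤ 8 → ω.meanEnergy (hubbardTTPrimeFermionInteraction 1 (p .tpOverT) (p .UOverT)) 1 ∈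
            Set.Icc (-1.6663911992 : ℝ) (1.0712784075)) ∧
          (8 ≤ p .UOverT → ω.meanEnergy (hubbardTTPrimeFermionInteraction 1 (p .tpOverT) (p .UOverT)) 1 ∈
            Set.Icc (-1.1092911992 : ℝ) (1.4700185963))) boxNCCOM_M20v19 := by
  have hΘ2r : ((Θ.snd : ℚ) : ℝ) ≤ (((39 / 400 : ℚ)) : ℝ) := by exact_mod_cast hΘ2
  exact boxNCCOM_M20v19_ttPrimeThermal_of_cellWindow (k := 4)
    (P := fun u e => (u ≤ 8 → e ∈ Set.Icc (-1.6663911992 : ℝ) (1.0712784075)) ∧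
      (8 ≤ u → e ∈ Set.Icc (-1.1092911992 : ℝ) (1.4700185963)))
    (fun β hle s U n hs1 hs2 hU1 hU2 hn1 hn2 ω Ls hLs h =>
      nccoMCell_ttPrimeThermal_windowU_of_le_4 hC2 hC1 hle hs1 hs2 hU1 hU2 hn1 hn2 hLs h)
    hΘ (by push_cast at hΘ2r; linarith) hk

/-- **The D-0099 map instance**: temperature cell `Θ = [1/2000, 39/400]` eV (≈ 5.8 K … 1131 K ⊇ every map row): `e(ω) ∈ [−1.6663911992, 1.4700185963]`
on `boxNCCOM_M20v19`. [cite: Israel1979, Thm. I.3.4] -/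
theorem boxNCCOM_M20v19_ttPrimeThermal_window_b4_maps (hC2 : cert_c2sector_tp1o4_3x3_b4_j273931) (hC1 : cert_feC1_3x2_b1o8_j263703)
    {kT : ℝ} (hk : kT ∈ (⟨(1/2000, 39/400), by norm_num⟩ : NonemptyInterval ℚ).ratCast ℝ) :
    HoldsOn (fun p : OneBandCoord → ℝ => ∀ β' : ℝ, p .tEV / kT ≤ β' →
      ∀ (ω : InfVolFermionState 2) (Ls : ℕ → ℕ), Tendsto Ls atTop atTop →
        ω.IsTorusLimitOfMixture (sectorGibbsCount (p .filling))
          (fun L => sectorGibbsWeightTT' β' 1 (p .tpOverT) (p .UOverT) (p .filling) L)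
          (fun L => sectorGibbsVectorTT' 1 (p .tpOverT) (p .UOverT) (p .filling) L) Ls →
        ω.meanEnergy (hubbardTTPrimeFermionInteraction 1 (p .tpOverT) (p .UOverT)) 1 ∈
          Set.Icc (-1.6663911992 : ℝ) (1.4700185963)) boxNCCOM_M20v19 :=
  boxNCCOM_M20v19_ttPrimeThermal_window_b4 hC2 hC1 (by norm_num) (by norm_num) hk

end Summit.Ventures.CertifiedManyBodySolver.Downfold

end
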